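import Summits.MatrixMultiplication.MatrixMultiplication.Theorems.CwSquareDegeneratesToMM232
import Summits.MatrixMultiplication.MatrixMultiplication.Theorems.CwSquareDegeneratesToMM322
import Literature.Barriers.MatrixMultiplication.UniversalMethodBarrierProducts
import Literature.Barriers.MatrixMultiplication.RectangularBarrier
import Literature.Computability.AlgebraicComplexity.PencilRankVersusBorderRank
import Literature.Computability.AlgebraicComplexity.BorderRankMatMulSmall
import Literature.Computability.AlgebraicComplexity.CoppersmithWinograd1990Proofs

/-!
# CwSixthPowerHostsMM12 — `⟨12,12,12⟩ ⊴ cw₂^{⊠6}`, the `ε ≥ 1/4` rung of `CwTwoMMPerfect` (degeneration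
form), and the exact level-2 square row `⟨m,m,m⟩ ⊴ cw₂^{⊠2} ↔ m ≤ 2`
(decomp-mm lens 6, gen 11; assembles `CwSquareDegeneratesToMM223/232/322`)

* `mm12_deg_cwTwoPow_six` — **`⟨12,12,12⟩ ⊴ cw₂^{⊠6}`** over every commutative ring (order `3`):
  Kronecker product of the three first-order rotations `⟨2,2,3⟩ ⊠ ⟨2,3,2⟩ ⊠ ⟨3,2,2⟩ = ⟨12,12,12⟩`
  (`AlgDegeneratesTo.kronecker`, `tensorRestrictsTo_kronecker_matMulTensor`, relabelling
  `kroneckerPow_six_restrictsTo`).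
* `cwTwoMMPerfectDeg_witness_six_twelve`, `cwTwoMMPerfectDeg_rhs_upTo_six` — the `N = 6`, `m = 12`
  line of the degeneration form of `CwTwoMMPerfect` (route `OutsiderSandwich`, TOP crux item
  `stmt-MatrixMultiplication-27896`; degeneration form = aside `CwTwoMMPerfectDegIff`, item 30535, PROVED)
  holds for every `ε ≥ 1/4` (`3^{(1-ε)·6} ≤ 3^{4.5} = 81√3 ≤ 144 = 12²`; exact threshold
  `ε* = 1 - log₃144 / 6 = 0.2460`).  In the route's finite profile: `log₂ 144 / 6 = 1.195` bits per copy
  by DEGENERATION at level `6`, against the restriction records `1` (level 2, items 28736/29787) and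
  `log₂9/3 = 1.057` (level 3, `CwCubeHostsMMThree`, lens-6 g10); per-copy MM volume `12^{1/2} = 3.464`
  against `3` (the perfect value is `3^{3/2} = 5.196`).
* `not_mm3_deg_cwTwoPow_two`, `mmSq_deg_cwTwoPow_two_iff` — the level-`2` row of the square
  DEGENERATION profile of `cw₂` is EXACTLY `m = 2`: `⟨m,m,m⟩ ⊴ cw₂^{⊠2} ↔ m ≤ 2` over `ℂ`
  (`m = 2`: from `⟨2,2,3⟩ ⊴ cw₂^{⊠2}` by zero-padding; `m = 3` is impossible even as a degeneration:
  `R(cw₂) ≤ 4` by the Waring decomposition of `x₀(x₁² + x₂²) = x₀(x₁+ix₂)(x₁−ix₂)` (inline in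
  `unitSixteen_restrictsTo_cwTwoPow_two`; the tree's `tensorRank_cwTensor_two_le_four`,
  `Theorems/SoloInformedCwTwoPattern`, is the same bound but that module is not built on the farm snapshot),
  hence `R(cw₂^{⊠2}) ≤ 16` by submultiplicativity (`tensorRank_kroneckerPow_add_le`), and a degeneration
  `⟨16⟩ ≥ cw₂^{⊠2} ⊵ ⟨3,3,3⟩` would force `R̲(⟨3,3,3⟩) ≤ 16`
  (`MatrixPencil.algBorderRank_le_of_algDegeneratesTo_unitTensor`), against Conner–Harper–Landsberg's
  `R̲(⟨3,3,3⟩) ≥ 17` — the named fact `ConnerHarperLandsberg2023_thm_1_1`, taken as a hypothesis here and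
  DISCHARGED in the tree by `ConnerHarperLandsberg2023_thm_1_1_holds` (`BorderRankMatMulThreeSeventeen.lean`;
  not imported, to keep this file light)).

Reading via `cw₂^{⊠2} ≅ perm₃` (arXiv:1909.04785 Lemma 2.10; arXiv:2009.11391 Thm 1.1: `R̲(perm₃) = 16`):
`⟨2,2,3⟩ ⊴₁ perm₃`, **`⟨3,3,3⟩ ⋬ perm₃`**, `⟨12,12,12⟩ ⊴ perm₃^{⊠3}`, and (tree,
`six_le_subrank_kroneckerPow_cwTensor_two_two`) `Q(perm₃) ≥ 6`.
Census context (markdown node NODE-g11 of the decomp-mm cell): `⟨2,2,4⟩ ⊴ cw₂^{⊠2}`, `⟨2,3,3⟩ ⊴ cw₂^{⊠2}`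
are numerically false (ALS degeneration floors) with no merging-combinatorial certificate in `> 3·10⁶`
search nodes — UNDECIDED; the restriction `⟨2,2,3⟩ ≤ cw₂^{⊠2}` is numerically false — UNDECIDED.

Sources: BurgisserClausenShokrollahi1997 ((15.25)–(15.26), Rem. (15.44)); Blaser2013 (§5–§7,
`⟨k,m,n⟩ ⊗ ⟨k',m',n'⟩ = ⟨kk',mm',nn'⟩`, Lemma 5.8); ConnerGesmundoLandsbergVentura2022 (§1, Lemma 2.10);
ConnerHuangLandsberg2020 (Thm 1.1); ConnerHarperLandsberg2023 (arXiv:1911.07981, Thm 1.1).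
-/

open Literature.Computability.AlgebraicComplexity
open scoped BigOperators
open Literature.Barriers.MatrixMultiplication (tensorRestrictsTo_kronecker_matMulTensor
  tensorRestrictsTo_matMulTensor_of_le)
open Summit.MatrixMultiplication.MatrixMultiplication.Theorems.CwSquareDegeneratesToMM223
open Summit.MatrixMultiplication.MatrixMultiplication.Theorems.CwSquareDegeneratesToMM232
open Summit.MatrixMultiplication.MatrixMultiplication.Theorems.CwSquareDegeneratesToMM322

set_option linter.dupNamespace false -- `MatrixMultiplication.MatrixMultiplication` (summit = problem, D-0017)

namespace Summit.MatrixMultiplication.MatrixMultiplication.Theorems.CwSixthPowerHostsMM12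

variable (R : Type) [CommRing R]

/-! ## `⟨12,12,12⟩ ⊴ cw₂^{⊠6}` and the `ε ≥ 1/4` rung -/

/-- `(cw₂ ⊠ cw₂)^{⊠3}` (nested pairs) degenerates (order `3`) to `⟨12,12,12⟩`:
`⟨2,2,3⟩ ⊠ ⟨2,3,2⟩ ⊠ ⟨3,2,2⟩ = ⟨12,12,12⟩`. [new] -/
theorem mm12_deg_cwTwoSq_cube :
    AlgDegeneratesTo
      (kroneckerTensor
        (kroneckerTensor (kroneckerTensor (cwTensor R 2) (cwTensor R 2))
          (kroneckerTensor (cwTensor R 2) (cwTensor R 2)))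
        (kroneckerTensor (cwTensor R 2) (cwTensor R 2)))
      (matMulTensor R 12 12 12) := by
  have d := ((MM223.algDegeneratesTo R).kronecker (MM232.algDegeneratesTo R)).kronecker
    (MM322.algDegeneratesTo R)
  have r₁ := ((tensorRestrictsTo_kronecker_matMulTensor R 2 2 3 2 3 2).kronecker
    (TensorRestrictsTo.refl (matMulTensor R 3 2 2))).trans
      (tensorRestrictsTo_kronecker_matMulTensor R (2 * 2) (2 * 3) (3 * 2) 3 2 2)
  have h := d.trans_restrictsTo r₁
  simpa using h

/-- **`⟨12,12,12⟩ ⊴ cw₂^{⊠6}`** (`kroneckerPow (cwTensor R 2) 6`), over any commutative ring `R`: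
the level-`6` square-matrix-multiplication degeneration value of `cw₂` is at least `m = 12`
(`m² = 144` of the flattening ceiling `3⁶ = 729`). [new] -/
theorem mm12_deg_cwTwoPow_six :
    AlgDegeneratesTo (kroneckerPow (cwTensor R 2) 6) (matMulTensor R 12 12 12) :=
  (kroneckerPow_six_restrictsTo R _).algDegeneratesTo_trans (mm12_deg_cwTwoSq_cube R)

/-- `⟨12,12,12⟩ ⊴ cw₂^{⊠6}` over `ℂ`. [new] -/
theorem mm12_deg_cwTwoPow_six_complex :
    AlgDegeneratesTo (kroneckerPow (cwTensor ℂ 2) 6) (matMulTensor ℂ 12 12 12) :=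
  mm12_deg_cwTwoPow_six ℂ

/-- `81 · √3 ≤ 144`, i.e. `3^{9/2} ≤ 12²`. [folklore] -/
theorem sqrt_three_le : Real.sqrt 3 ≤ 16 / 9 := by
  have h : Real.sqrt 3 ≤ Real.sqrt ((16 / 9) ^ 2) := Real.sqrt_le_sqrt (by norm_num)
  rwa [Real.sqrt_sq (by norm_num)] at h

/-- The `N = 6`, `m = 12` line of the DEGENERATION form of `CwTwoMMPerfect` (right-hand side of
`CwTwoMMPerfectDegIff`, item 30535): for every `ε ≥ 1/4`, `3^{(1-ε)·6} ≤ 3^{9/2} = 81√3 ≤ 144 = 12²`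
and `⟨12,12,12⟩ ⊴ cw₂^{⊠6}`.  (Exact threshold `ε* = 1 - log₃144/6 ≈ 0.2460`; the level-3 restriction
line `cwTwoMMPerfect_witness_three_three` needs `ε ≥ 1/3`.) [new] -/
theorem cwTwoMMPerfectDeg_witness_six_twelve {ε : ℝ} (hε : 1 / 4 ≤ ε) :
    ∃ m : ℕ, AlgDegeneratesTo (kroneckerPow (cwTensor ℂ 2) 6) (matMulTensor ℂ m m m) ∧
      (3 : ℝ) ^ ((1 - ε) * (6 : ℕ)) ≤ (m : ℝ) ^ 2 := by
  refine ⟨12, mm12_deg_cwTwoPow_six ℂ, ?_⟩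
  have h1 : (1 - ε) * ((6 : ℕ) : ℝ) ≤ ((4 : ℕ) : ℝ) + 1 / 2 := by push_cast; nlinarith
  calc (3 : ℝ) ^ ((1 - ε) * ((6 : ℕ) : ℝ)) ≤ (3 : ℝ) ^ (((4 : ℕ) : ℝ) + 1 / 2) :=
        Real.rpow_le_rpow_of_exponent_le (by norm_num) h1
    _ = (3 : ℝ) ^ ((4 : ℕ) : ℝ) * (3 : ℝ) ^ (1 / (2 : ℝ)) := Real.rpow_add (by norm_num) _ _
    _ = 81 * Real.sqrt 3 := by rw [Real.rpow_natCast, Real.sqrt_eq_rpow]; norm_num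
    _ ≤ 81 * (16 / 9) := by gcongr; exact sqrt_three_le
    _ = ((12 : ℕ) : ℝ) ^ 2 := by norm_num

/-- The same line as an instance of the full right-hand side of `CwTwoMMPerfectDegIff` restricted to
`N₀ ≤ 6` and `ε ≥ 1/4` (so the degeneration profile of `cw₂` meets the `ε = 1/4` demand already at
level `6`). [new] -/
theorem cwTwoMMPerfectDeg_rhs_upTo_six {ε : ℝ} (hε : 1 / 4 ≤ ε) {N₀ : ℕ} (hN₀ : N₀ ≤ 6) :
    ∃ N : ℕ, N₀ ≤ N ∧ ∃ m : ℕ,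
      AlgDegeneratesTo (kroneckerPow (cwTensor ℂ 2) N) (matMulTensor ℂ m m m) ∧
        (3 : ℝ) ^ ((1 - ε) * N) ≤ (m : ℝ) ^ 2 :=
  ⟨6, hN₀, cwTwoMMPerfectDeg_witness_six_twelve hε⟩

/-! ## The exact level-`2` row: `⟨m,m,m⟩ ⊴ cw₂^{⊠2} ↔ m ≤ 2` -/

/-- `t ≥ t^{⊠1}` (relabelling `Fin 1 → ι` against `ι`). [folklore] -/
theorem restrictsTo_kroneckerPow_one {ι κ μ : Type} [Fintype ι] [Fintype κ] [Fintype μ]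
    [DecidableEq ι] [DecidableEq κ] [DecidableEq μ] (t : ι → κ → μ → R) :
    TensorRestrictsTo t (kroneckerPow t 1) := by
  have e : kroneckerPow t 1 = fun a b c => t (a 0) (b 0) (c 0) := by
    funext a b c
    simp [kroneckerPow_apply]
  rw [e]
  exact tensorRestrictsTo_precomp _ _ _ _

/-- `R(cw₂^{⊠2}) ≤ 16` over `ℂ`, hence `⟨16⟩ ≥ cw₂^{⊠2}`: `R(cw₂) ≤ 4` by the Waring decomposition
`x₀(x₁² + x₂²) = abc`, `a = x₀`, `b = x₁ + ix₂`, `c = x₁ − ix₂`, `abc = (1/24) Σ ε₂ε₃ (a + ε₂b + ε₃c)³`, i.e.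
`cw₂ = (1/8) Σ_{ε₂,ε₃ = ±1} ε₂ε₃ · m_ε ⊗ m_ε ⊗ m_ε` with `m_ε = e₀* + (ε₂+ε₃)e₁* + i(ε₂−ε₃)e₂*` (the tree's
`tensorRank_cwTensor_two_le_four`, file `Theorems/SoloInformedCwTwoPattern`, states `R(cw₂) ≤ 4` too; it is
re-derived inline here because that module is not built on the farm snapshot), then submultiplicativity
`R(t^{⊠(1+1)}) ≤ R(t^{⊠1})²` (`tensorRank_kroneckerPow_add_le`). [cite: ConnerHuangLandsberg2020, §1] -/
theorem unitSixteen_restrictsTo_cwTwoPow_two :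
    TensorRestrictsTo (unitTensor ℂ 16) (kroneckerPow (cwTensor ℂ 2) 2) := by
  have h4 : tensorRank (cwTensor ℂ 2) ≤ 4 := by
    refine tensorRank_le_of_eq_sum
      (fun ρ a => (![1 / 8, -1 / 8, -1 / 8, 1 / 8] : Fin 4 → ℂ) ρ *
        (![![1, 2, 0], ![1, 0, 2 * Complex.I], ![1, 0, -2 * Complex.I], ![1, -2, 0]] :
          Fin 4 → Fin 3 → ℂ) ρ a)
      (![![1, 2, 0], ![1, 0, 2 * Complex.I], ![1, 0, -2 * Complex.I], ![1, -2, 0]] :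
        Fin 4 → Fin 3 → ℂ)
      (![![1, 2, 0], ![1, 0, 2 * Complex.I], ![1, 0, -2 * Complex.I], ![1, -2, 0]] :
        Fin 4 → Fin 3 → ℂ) ?_
    funext a b c
    rw [sum_triad_apply, cwTensor_apply]
    fin_cases a <;> fin_cases b <;> fin_cases c <;>
      simp [Fin.sum_univ_four] <;> ring_nf <;> simp [Complex.I_sq]
  refine tensorRestrictsTo_unitTensor_of_tensorRank_le _ ?_
  have h1 : tensorRank (kroneckerPow (cwTensor ℂ 2) 1) ≤ 4 :=
    (restrictsTo_kroneckerPow_one ℂ (cwTensor ℂ 2)).tensorRank_le.trans h4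
  calc tensorRank (kroneckerPow (cwTensor ℂ 2) 2)
        = tensorRank (kroneckerPow (cwTensor ℂ 2) (1 + 1)) := rfl
    _ ≤ tensorRank (kroneckerPow (cwTensor ℂ 2) 1) * tensorRank (kroneckerPow (cwTensor ℂ 2) 1) :=
        tensorRank_kroneckerPow_add_le _ 1 1
    _ ≤ 4 * 4 := Nat.mul_le_mul h1 h1

/-- **`⟨3,3,3⟩` is NOT a degeneration of `cw₂^{⊠2}`** (`≅ perm₃`), over `ℂ`: `⟨16⟩ ≥ cw₂^{⊠2}`
(`unitSixteen_restrictsTo_cwTwoPow_two`); a degeneration `cw₂^{⊠2} ⊵ ⟨3,3,3⟩` would give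
`⟨16⟩ ⊵ ⟨3,3,3⟩`, i.e. `R̲(⟨3,3,3⟩) ≤ 16` (`MatrixPencil.algBorderRank_le_of_algDegeneratesTo_unitTensor`),
contradicting `R̲(⟨3,3,3⟩) ≥ 17` (Conner–Harper–Landsberg 2023 Thm. 1.1 = the named fact
`ConnerHarperLandsberg2023_thm_1_1`, hypothesis `h17`; DISCHARGED in the tree by
`ConnerHarperLandsberg2023_thm_1_1_holds`, file `BorderRankMatMulThreeSeventeen.lean`, not imported
here to keep this file light). [new] -/
theorem not_mm3_deg_cwTwoPow_two (h17 : ConnerHarperLandsberg2023_thm_1_1) :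
    ¬ AlgDegeneratesTo (kroneckerPow (cwTensor ℂ 2) 2) (matMulTensor ℂ 3 3 3) := by
  intro h
  have h16 : algBorderRank (matMulTensor ℂ 3 3 3) ≤ 16 :=
    MatrixPencil.algBorderRank_le_of_algDegeneratesTo_unitTensor
      (unitSixteen_restrictsTo_cwTwoPow_two.algDegeneratesTo_trans h)
  have h17' : 17 ≤ algBorderRank (matMulTensor ℂ 3 3 3) := h17
  omega

/-- **The level-`2` row of the square degeneration profile of `cw₂` is exactly `m = 2`**:
`⟨m,m,m⟩ ⊴ cw₂^{⊠2} ↔ m ≤ 2` over `ℂ` (`←`: zero-padding `⟨m,m,m⟩ ≤ ⟨2,2,3⟩ ⊴ cw₂^{⊠2}`;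
`→`: `⟨3,3,3⟩ ≤ ⟨m,m,m⟩` for `m ≥ 3` and `not_mm3_deg_cwTwoPow_two`).  So at `N = 2` the
degeneration form of `CwTwoMMPerfect` (`CwTwoMMPerfectDegIff`) has `m² ≤ 4 < 9 = 3²`: level `2` is
not perfect even by degeneration, although its rectangular degeneration volume is `12 > 9`.
(Hypothesis `h17 : ConnerHarperLandsberg2023_thm_1_1`, discharged in the tree.) [new] -/
theorem mmSq_deg_cwTwoPow_two_iff (h17 : ConnerHarperLandsberg2023_thm_1_1) (m : ℕ) :
    AlgDegeneratesTo (kroneckerPow (cwTensor ℂ 2) 2) (matMulTensor ℂ m m m) ↔ m ≤ 2 := by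
  constructor
  · intro h
    by_contra hm
    have hm : 3 ≤ m := by omega
    exact not_mm3_deg_cwTwoPow_two h17
      (h.trans_restrictsTo (tensorRestrictsTo_matMulTensor_of_le ℂ hm hm hm))
  · intro hm
    exact (mm223_deg_cwTwoPow_two ℂ).trans_restrictsTo
      (tensorRestrictsTo_matMulTensor_of_le ℂ hm hm (hm.trans (by norm_num)))

end Summit.MatrixMultiplication.MatrixMultiplication.Theorems.CwSixthPowerHostsMM12
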